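import Summits.QuantumAdvantage.QuantumAdvantage.Theorems.SymplecticPurityDlogGraphFlatFDMReduce

/-!
# Crux `DlogGraphFlat` (stmt-QuantumAdvantage-10732), line `Sketch` — sector B: gluing DCB from its
# pair part and its fourfold part (`stub_dlogGlueDCB`)

DCB (the sign-free non-paired fourth dilation-correlation bound consumed by `stub_dlogFDMweakOfDCB`)
is derived, with the digit mask chosen as the LOW block `D = {j < m}`, `m = ⌊min(μ₁,μ₂,1)·n⌋`, from

* PairS: `Σ_{0<h<2^m} |Σ_λ F_β(λ)F_β(λ gʰ)| ≤ C₁ 2^{(1−κ₁)m} p` (pair correlations along `gʰ`), and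
* QuadS: `Σ_{q pairwise distinct} |Σ_λ Π_k F_β(λ g^{u_k})| ≤ C₂ 2^{(3−κ₂)m} p` (genuinely fourfold part).

A non-paired 4-tuple of low patterns is either pairwise distinct, or has a coincidence `uᵢ = uⱼ` whose
complementary two entries are distinct; then `F² = 1` collapses its correlation to a pair correlation
`|Σ_λ F(λ g^c)F(λ g^d)| = |Σ_λ F(λ)F(λ g^{|c−d|})|` (substitution `λ ↦ λ g^{min}`, `g` a unit), with
`0 < |c − d| < 2^m`. Summing the six coincidence positions over the cube gives
`6·|U|·Σ_a Σ_{b≠a} |pair(a,b)| ≤ 12·4^m·PairS` (`sum_six_coincidence`, `row_corr_le`), whence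
`DCB ≤ (12 C₁ + C₂) 2^{(3−κ)m} p`, `κ = min κ₁ κ₂`. Pure finite algebra; no new definitions.
-/

set_option linter.dupNamespace false -- D-0017: single-problem summit ⇒ `QuantumAdvantage.QuantumAdvantage` by design

namespace Summit.QuantumAdvantage.QuantumAdvantage.Theorems.SymplecticPurity

open Finset Literature.Computability.QuantumComplexity Literature.Computability.Cryptography
open Literature.Computability.AlgebraicComplexity.BoolGadgets (ofBits_injective)

section GlueDCB

variable {n : ℕ}

/-- Counting the six coincidence positions over the cube `s⁴`: each contributes `|s| · Σ_a Σ_b Φ a b`. -/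
theorem sum_six_coincidence {ι : Type*} [DecidableEq ι] (s : Finset ι) (Φ : ι → ι → ℝ) :
    ∑ q ∈ (s ×ˢ s) ×ˢ (s ×ˢ s),
      ((if q.1.1 = q.1.2 then Φ q.2.1 q.2.2 else 0) + (if q.1.1 = q.2.1 then Φ q.1.2 q.2.2 else 0) +
        (if q.1.1 = q.2.2 then Φ q.1.2 q.2.1 else 0) + (if q.1.2 = q.2.1 then Φ q.1.1 q.2.2 else 0) +
        (if q.1.2 = q.2.2 then Φ q.1.1 q.2.1 else 0) + (if q.2.1 = q.2.2 then Φ q.1.1 q.1.2 else 0)) =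
      6 * (s.card * ∑ a ∈ s, ∑ b ∈ s, Φ a b) := by
  simp only [Finset.sum_add_distrib, Finset.sum_product, Finset.sum_ite_irrel, Finset.sum_ite_eq,
    Finset.sum_const_zero, Finset.sum_ite_mem, Finset.inter_self, Finset.sum_const, nsmul_eq_mul]
  simp only [← Finset.mul_sum]
  ring

/-- Pointwise: for a non-paired 4-tuple and `±1`-valued `f`, the fourfold correlation is either the
pairwise-distinct term or (after `f² = 1`) the pair correlation of the two entries complementary to a
coincidence. -/
theorem abs_corr_le_of_not_paired {ι Λ : Type*} [DecidableEq ι] [Fintype Λ] (f : ι → Λ → ℝ)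
    (hf : ∀ u l, f u l * f u l = 1) (a b c d : ι)
    (hq : ¬ ((a = b ∧ c = d) ∨ (a = c ∧ b = d) ∨ (a = d ∧ b = c))) :
    |∑ l, f a l * f b l * (f c l * f d l)| ≤
      (if (a ≠ b ∧ a ≠ c ∧ a ≠ d ∧ b ≠ c ∧ b ≠ d ∧ c ≠ d)
        then |∑ l, f a l * f b l * (f c l * f d l)| else 0) +
      ((if a = b then (if c = d then 0 else |∑ l, f c l * f d l|) else 0) +
        (if a = c then (if b = d then 0 else |∑ l, f b l * f d l|) else 0) +
        (if a = d then (if b = c then 0 else |∑ l, f b l * f c l|) else 0) +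
        (if b = c then (if a = d then 0 else |∑ l, f a l * f d l|) else 0) +
        (if b = d then (if a = c then 0 else |∑ l, f a l * f c l|) else 0) +
        (if c = d then (if a = b then 0 else |∑ l, f a l * f b l|) else 0)) := by
  have hnn : ∀ (P R : Prop) [Decidable P] [Decidable R] (x : ℝ),
      0 ≤ (if P then (if R then 0 else |x|) else 0) := fun P R _ _ x => by
    split_ifs <;> first | exact le_rfl | exact abs_nonneg _
  have h1 := hnn (a = b) (c = d) (∑ l, f c l * f d l)
  have h2 := hnn (a = c) (b = d) (∑ l, f b l * f d l)
  have h3 := hnn (a = d) (b = c) (∑ l, f b l * f c l)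
  have h4 := hnn (b = c) (a = d) (∑ l, f a l * f d l)
  have h5 := hnn (b = d) (a = c) (∑ l, f a l * f c l)
  have h6 := hnn (c = d) (a = b) (∑ l, f a l * f b l)
  by_cases hdi : (a ≠ b ∧ a ≠ c ∧ a ≠ d ∧ b ≠ c ∧ b ≠ d ∧ c ≠ d)
  · rw [if_pos hdi]; linarith
  rw [if_neg hdi, zero_add]
  simp only [not_and_or, ne_eq, not_not] at hdi
  rcases hdi with h | h | h | h | h | h
  · have h' : ¬ c = d := fun h' => hq (Or.inl ⟨h, h'⟩)
    have e : (if a = b then (if c = d then (0 : ℝ) else |∑ l, f c l * f d l|) else 0) =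
        |∑ l, f c l * f d l| := by rw [if_pos h, if_neg h']
    rw [Finset.sum_congr rfl fun l _ => show f a l * f b l * (f c l * f d l) = f c l * f d l by
      rw [h, hf, one_mul]]
    linarith
  · have h' : ¬ b = d := fun h' => hq (Or.inr (Or.inl ⟨h, h'⟩))
    have e : (if a = c then (if b = d then (0 : ℝ) else |∑ l, f b l * f d l|) else 0) =
        |∑ l, f b l * f d l| := by rw [if_pos h, if_neg h']
    rw [Finset.sum_congr rfl fun l _ => show f a l * f b l * (f c l * f d l) = f b l * f d l by
      rw [h, mul_mul_mul_comm, hf, one_mul]]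
    linarith
  · have h' : ¬ b = c := fun h' => hq (Or.inr (Or.inr ⟨h, h'⟩))
    have e : (if a = d then (if b = c then (0 : ℝ) else |∑ l, f b l * f c l|) else 0) =
        |∑ l, f b l * f c l| := by rw [if_pos h, if_neg h']
    rw [Finset.sum_congr rfl fun l _ => show f a l * f b l * (f c l * f d l) = f b l * f c l by
      rw [h, mul_comm (f c l) (f d l), mul_mul_mul_comm, hf, one_mul]]
    linarith
  · have h' : ¬ a = d := fun h' => hq (Or.inr (Or.inr ⟨h', h⟩))
    have e : (if b = c then (if a = d then (0 : ℝ) else |∑ l, f a l * f d l|) else 0) =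
        |∑ l, f a l * f d l| := by rw [if_pos h, if_neg h']
    rw [Finset.sum_congr rfl fun l _ => show f a l * f b l * (f c l * f d l) = f a l * f d l by
      rw [h, mul_assoc, ← mul_assoc (f c l) (f c l) (f d l), hf, one_mul]]
    linarith
  · have h' : ¬ a = c := fun h' => hq (Or.inr (Or.inl ⟨h', h⟩))
    have e : (if b = d then (if a = c then (0 : ℝ) else |∑ l, f a l * f c l|) else 0) =
        |∑ l, f a l * f c l| := by rw [if_pos h, if_neg h']
    rw [Finset.sum_congr rfl fun l _ => show f a l * f b l * (f c l * f d l) = f a l * f c l by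
      rw [h, mul_mul_mul_comm, hf, mul_one]]
    linarith
  · have h' : ¬ a = b := fun h' => hq (Or.inl ⟨h', h⟩)
    have e : (if c = d then (if a = b then (0 : ℝ) else |∑ l, f a l * f b l|) else 0) =
        |∑ l, f a l * f b l| := by rw [if_pos h, if_neg h']
    rw [Finset.sum_congr rfl fun l _ => show f a l * f b l * (f c l * f d l) = f a l * f b l by
      rw [h, hf, mul_one]]
    linarith

/-- The abstract gluing inequality: the non-paired part of the sign-free fourfold correlation sum over
`s⁴` is at most its pairwise-distinct part plus `6|s|` times the off-diagonal pair-correlation sum. -/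
theorem sum_nonpaired_le {ι Λ : Type*} [DecidableEq ι] [Fintype Λ] (f : ι → Λ → ℝ)
    (hf : ∀ u l, f u l * f u l = 1) (s : Finset ι) :
    ∑ q ∈ ((s ×ˢ s) ×ˢ (s ×ˢ s)).filter (fun q => ¬ ((q.1.1 = q.1.2 ∧ q.2.1 = q.2.2) ∨
        (q.1.1 = q.2.1 ∧ q.1.2 = q.2.2) ∨ (q.1.1 = q.2.2 ∧ q.1.2 = q.2.1))),
      |∑ l, f q.1.1 l * f q.1.2 l * (f q.2.1 l * f q.2.2 l)| ≤
    ∑ q ∈ ((s ×ˢ s) ×ˢ (s ×ˢ s)).filter (fun q => q.1.1 ≠ q.1.2 ∧ q.1.1 ≠ q.2.1 ∧ q.1.1 ≠ q.2.2 ∧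
        q.1.2 ≠ q.2.1 ∧ q.1.2 ≠ q.2.2 ∧ q.2.1 ≠ q.2.2),
      |∑ l, f q.1.1 l * f q.1.2 l * (f q.2.1 l * f q.2.2 l)| +
    6 * (s.card * ∑ a ∈ s, ∑ b ∈ s, (if a = b then 0 else |∑ l, f a l * f b l|)) := by
  conv_rhs => rw [Finset.sum_filter,
    ← sum_six_coincidence s (fun a b => if a = b then 0 else |∑ l, f a l * f b l|),
    ← Finset.sum_add_distrib]
  refine (Finset.sum_le_sum fun q hq => abs_corr_le_of_not_paired f hf q.1.1 q.1.2 q.2.1 q.2.2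
    (Finset.mem_filter.1 hq).2).trans ?_
  exact Finset.sum_le_sum_of_subset_of_nonneg (Finset.filter_subset _ _) fun q _ _ => by positivity

/-- Substitution `λ ↦ λ Gᵃ` (`G` a unit): `Σ_λ F(λGᵃ)F(λG^{a+t}) = Σ_λ F(λ)F(λGᵗ)`. -/
theorem sum_pair_shift {p : ℕ} [Fact p.Prime] (F : ZMod p → ℝ) (G : ZMod p) (hG : G ≠ 0)
    (a t : ℕ) : ∑ lam : ZMod p, F (lam * G ^ a) * F (lam * G ^ (a + t)) =
      ∑ lam : ZMod p, F lam * F (lam * G ^ t) := by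
  rw [← (mulRight_bijective₀ (G ^ a) (pow_ne_zero _ hG)).sum_comp (fun μ => F μ * F (μ * G ^ t))]
  simp only [pow_add, mul_assoc]

/-- The same substitution with the factors swapped. -/
theorem sum_pair_shift' {p : ℕ} [Fact p.Prime] (F : ZMod p → ℝ) (G : ZMod p) (hG : G ≠ 0)
    (a t : ℕ) : ∑ lam : ZMod p, F (lam * G ^ (a + t)) * F (lam * G ^ a) =
      ∑ lam : ZMod p, F lam * F (lam * G ^ t) := by
  rw [← sum_pair_shift F G hG a t]
  exact Finset.sum_congr rfl fun _ _ => mul_comm _ _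

/-- A pattern vanishing from digit `m` on has value `< 2^m`. -/
theorem ofBits_lt_of_high (m : ℕ) (u : QReg n) (hu : ∀ j : Fin n, m ≤ (j : ℕ) → u j = false) :
    Nat.ofBits u < 2 ^ m := by
  refine Nat.lt_pow_two_of_testBit _ fun i hi => ?_
  rw [Nat.testBit_ofBits]
  split_ifs with h
  · exact hu ⟨i, h⟩ hi
  · rfl

/-- Row sums of the off-diagonal pair correlations over patterns of value `< 2^m`: each height
`h = |ofBits b − ofBits a| ∈ [1, 2^m)` is hit by at most two `b` (one above, one below `a`). -/
theorem row_corr_le {p : ℕ} [Fact p.Prime] (F : ZMod p → ℝ) (G : ZMod p) (hG : G ≠ 0) (m : ℕ)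
    (U : Finset (QReg n)) (hU : ∀ u ∈ U, Nat.ofBits u < 2 ^ m) (a : QReg n)
    (ha : Nat.ofBits a < 2 ^ m) :
    ∑ b ∈ U, (if a = b then 0 else
        |∑ lam : ZMod p, F (lam * G ^ Nat.ofBits a) * F (lam * G ^ Nat.ofBits b)|) ≤
      2 * ∑ h ∈ Finset.Ico 1 (2 ^ m), |∑ lam : ZMod p, F lam * F (lam * G ^ h)| := by
  have hpt : ∀ b ∈ U, (if a = b then 0 else
      |∑ lam : ZMod p, F (lam * G ^ Nat.ofBits a) * F (lam * G ^ Nat.ofBits b)|) ≤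
      (if Nat.ofBits a < Nat.ofBits b then
        |∑ lam : ZMod p, F lam * F (lam * G ^ (Nat.ofBits b - Nat.ofBits a))| else 0) +
      (if Nat.ofBits b < Nat.ofBits a then
        |∑ lam : ZMod p, F lam * F (lam * G ^ (Nat.ofBits a - Nat.ofBits b))| else 0) := by
    intro b _
    rcases lt_trichotomy (Nat.ofBits a) (Nat.ofBits b) with h | h | h
    · have hab : a ≠ b := fun hab => by rw [hab] at h; exact lt_irrefl _ h
      rw [if_neg hab, if_pos h, if_neg (not_lt.2 h.le), add_zero]
      obtain ⟨t, ht⟩ : ∃ t, Nat.ofBits b = Nat.ofBits a + t := ⟨_, (Nat.add_sub_cancel' h.le).symm⟩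
      rw [ht, Nat.add_sub_cancel_left, sum_pair_shift F G hG]
    · rw [if_pos (ofBits_injective h)]
      positivity
    · have hab : a ≠ b := fun hab => by rw [hab] at h; exact lt_irrefl _ h
      rw [if_neg hab, if_neg (not_lt.2 h.le), if_pos h, zero_add]
      obtain ⟨t, ht⟩ : ∃ t, Nat.ofBits a = Nat.ofBits b + t := ⟨_, (Nat.add_sub_cancel' h.le).symm⟩
      rw [ht, Nat.add_sub_cancel_left, sum_pair_shift' F G hG]
  refine (Finset.sum_le_sum hpt).trans ?_
  rw [Finset.sum_add_distrib, ← Finset.sum_filter, ← Finset.sum_filter, two_mul]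
  refine add_le_add ?_ ?_
  · have hinj : Set.InjOn (fun b : QReg n => Nat.ofBits b - Nat.ofBits a)
        ↑(U.filter fun b => Nat.ofBits a < Nat.ofBits b) := by
      intro b hb b' hb' h
      rw [Finset.coe_filter, Set.mem_setOf_eq] at hb hb'
      dsimp only at h
      exact ofBits_injective (by omega)
    rw [← Finset.sum_image (f := fun h => |∑ lam : ZMod p, F lam * F (lam * G ^ h)|) hinj]
    refine Finset.sum_le_sum_of_subset_of_nonneg (fun h hh => ?_) (fun _ _ _ => abs_nonneg _)
    obtain ⟨b, hb, rfl⟩ := Finset.mem_image.1 hh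
    rw [Finset.mem_filter] at hb
    have := hU b hb.1
    rw [Finset.mem_Ico]; omega
  · have hinj : Set.InjOn (fun b : QReg n => Nat.ofBits a - Nat.ofBits b)
        ↑(U.filter fun b => Nat.ofBits b < Nat.ofBits a) := by
      intro b hb b' hb' h
      rw [Finset.coe_filter, Set.mem_setOf_eq] at hb hb'
      dsimp only at h
      exact ofBits_injective (by omega)
    rw [← Finset.sum_image (f := fun h => |∑ lam : ZMod p, F lam * F (lam * G ^ h)|) hinj]
    refine Finset.sum_le_sum_of_subset_of_nonneg (fun h hh => ?_) (fun _ _ _ => abs_nonneg _)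
    obtain ⟨b, hb, rfl⟩ := Finset.mem_image.1 hh
    rw [Finset.mem_filter] at hb
    rw [Finset.mem_Ico]; omega

end GlueDCB

/-- **`stub_dlogGlueDCB`** (sector B, glue): the pair-sum bound PairS and the sign-free fourfold bound
QuadS over pairwise-distinct low patterns imply DCB with the digit mask `D = {j < m}`,
`m = ⌊min(μ₁,μ₂,1)·n⌋`, constants `κ = min κ₁ κ₂`, `μ = min(μ₁,μ₂,1)/2`, `C = 12C₁ + C₂`. -/
theorem stub_dlogGlueDCB :
    (∃ κ₁ : ℝ, 0 < κ₁ ∧ ∃ μ₁ : ℝ, 0 < μ₁ ∧ ∃ C : ℝ, 0 < C ∧ ∃ n₀ : ℕ, ∀ n ≥ n₀,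
      ∀ (p : ℕ) [Fact (Nat.Prime p)] (g : ℕ), p < 2 ^ n → 2 ^ n ≤ p + 2 ^ (53 * n / 100) →
      orderOf (g : ZMod p) = p - 1 →
      ∀ β : QReg n, β ≠ (fun _ => false) → ∀ m : ℕ, (m : ℝ) ≤ μ₁ * (n : ℝ) →
      ∑ h ∈ Finset.Ico 1 (2 ^ m),
        |∑ lam : ZMod p,
          (∏ i : Fin n, (if β i && (lam).val.testBit (i : ℕ) then (-1 : ℝ) else 1)) *
          (∏ i : Fin n, (if β i && (lam * (g : ZMod p) ^ h).val.testBit (i : ℕ) then (-1 : ℝ) else 1))| ≤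
        C * (2 : ℝ) ^ ((1 - κ₁) * (m : ℝ)) * (p : ℝ)) →
    (∃ κ₂ : ℝ, 0 < κ₂ ∧ ∃ μ₂ : ℝ, 0 < μ₂ ∧ ∃ C : ℝ, 0 < C ∧ ∃ n₀ : ℕ, ∀ n ≥ n₀,
      ∀ (p : ℕ) [Fact (Nat.Prime p)] (g : ℕ), p < 2 ^ n → 2 ^ n ≤ p + 2 ^ (53 * n / 100) →
      orderOf (g : ZMod p) = p - 1 →
      (∀ c : Fin (n + 1) → ℤ, (∀ i, c i = 0 ∨ c i = 1 ∨ c i = -1) →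
        ∑ i, c i * 2 ^ (i : ℕ) = (p : ℤ) - 1 → n ≤ 8 * (Finset.univ.filter fun i => c i ≠ 0).card) →
      ∀ β : QReg n, β ≠ (fun _ => false) → ∀ m : ℕ, (m : ℝ) ≤ μ₂ * (n : ℝ) →
      ∑ q ∈ (((Finset.univ.filter fun u : QReg n => ∀ j : Fin n, m ≤ (j : ℕ) → u j = false) ×ˢ
            (Finset.univ.filter fun u : QReg n => ∀ j : Fin n, m ≤ (j : ℕ) → u j = false)) ×ˢ
           ((Finset.univ.filter fun u : QReg n => ∀ j : Fin n, m ≤ (j : ℕ) → u j = false) ×ˢ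
            (Finset.univ.filter fun u : QReg n => ∀ j : Fin n, m ≤ (j : ℕ) → u j = false))).filter
            (fun q => q.1.1 ≠ q.1.2 ∧ q.1.1 ≠ q.2.1 ∧ q.1.1 ≠ q.2.2 ∧ q.1.2 ≠ q.2.1 ∧
              q.1.2 ≠ q.2.2 ∧ q.2.1 ≠ q.2.2),
        |∑ lam : ZMod p,
          (∏ i : Fin n, (if β i && (lam * (g : ZMod p) ^ Nat.ofBits q.1.1).val.testBit (i : ℕ) then (-1 : ℝ) else 1)) *
          (∏ i : Fin n, (if β i && (lam * (g : ZMod p) ^ Nat.ofBits q.1.2).val.testBit (i : ℕ) then (-1 : ℝ) else 1)) *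
          ((∏ i : Fin n, (if β i && (lam * (g : ZMod p) ^ Nat.ofBits q.2.1).val.testBit (i : ℕ) then (-1 : ℝ) else 1)) *
          (∏ i : Fin n, (if β i && (lam * (g : ZMod p) ^ Nat.ofBits q.2.2).val.testBit (i : ℕ) then (-1 : ℝ) else 1)))| ≤
        C * (2 : ℝ) ^ ((3 - κ₂) * (m : ℝ)) * (p : ℝ)) →
    ∃ κ : ℝ, 0 < κ ∧ ∃ μ : ℝ, 0 < μ ∧ ∃ C : ℝ, 0 < C ∧ ∃ n₀ : ℕ, ∀ n ≥ n₀,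
      ∀ (p : ℕ) [Fact (Nat.Prime p)] (g : ℕ), p < 2 ^ n → 2 ^ n ≤ p + 2 ^ (53 * n / 100) →
      orderOf (g : ZMod p) = p - 1 →
      (∀ c : Fin (n + 1) → ℤ, (∀ i, c i = 0 ∨ c i = 1 ∨ c i = -1) →
        ∑ i, c i * 2 ^ (i : ℕ) = (p : ℤ) - 1 → n ≤ 8 * (Finset.univ.filter fun i => c i ≠ 0).card) →
      ∀ β : QReg n, β ≠ (fun _ => false) →
      ∃ D : QReg n, μ * (n : ℝ) ≤ ((Finset.univ.filter fun j => D j = true).card : ℝ) ∧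
      ∑ q ∈ (((Finset.univ.filter fun u : QReg n => ∀ j : Fin n, D j = false → u j = false) ×ˢ
              (Finset.univ.filter fun u : QReg n => ∀ j : Fin n, D j = false → u j = false)) ×ˢ
            ((Finset.univ.filter fun u : QReg n => ∀ j : Fin n, D j = false → u j = false) ×ˢ
              (Finset.univ.filter fun u : QReg n => ∀ j : Fin n, D j = false → u j = false))).filter
          fun q => ¬ ((q.1.1 = q.1.2 ∧ q.2.1 = q.2.2) ∨ (q.1.1 = q.2.1 ∧ q.1.2 = q.2.2) ∨
            (q.1.1 = q.2.2 ∧ q.1.2 = q.2.1)),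
        |∑ lam : ZMod p,
          (∏ i : Fin n, (if β i && (lam * (g : ZMod p) ^ Nat.ofBits q.1.1).val.testBit (i : ℕ)
            then (-1 : ℝ) else 1)) *
          (∏ i : Fin n, (if β i && (lam * (g : ZMod p) ^ Nat.ofBits q.1.2).val.testBit (i : ℕ)
            then (-1 : ℝ) else 1)) *
          ((∏ i : Fin n, (if β i && (lam * (g : ZMod p) ^ Nat.ofBits q.2.1).val.testBit (i : ℕ)
            then (-1 : ℝ) else 1)) *
          (∏ i : Fin n, (if β i && (lam * (g : ZMod p) ^ Nat.ofBits q.2.2).val.testBit (i : ℕ)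
            then (-1 : ℝ) else 1)))| ≤
        C * (2 : ℝ) ^ ((3 - κ) * ((Finset.univ.filter fun j => D j = true).card : ℝ)) * p := by
  rintro ⟨κ₁, hκ₁, μ₁, hμ₁, C₁, hC₁, n₁, hP⟩ ⟨κ₂, hκ₂, μ₂, hμ₂, C₂, hC₂, n₂, hQ⟩
  -- constants
  set μ' : ℝ := min (min μ₁ μ₂) 1 with hμ'
  have hμ'0 : 0 < μ' := lt_min (lt_min hμ₁ hμ₂) one_pos
  have hμ'1 : μ' ≤ μ₁ := (min_le_left _ _).trans (min_le_left _ _)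
  have hμ'2 : μ' ≤ μ₂ := (min_le_left _ _).trans (min_le_right _ _)
  have hμ'3 : μ' ≤ 1 := min_le_right _ _
  refine ⟨min κ₁ κ₂, lt_min hκ₁ hκ₂, μ' / 2, by positivity, 12 * C₁ + C₂, by positivity,
    max (max n₁ n₂) ⌈2 / μ'⌉₊, ?_⟩
  intro n hn p hpF g hpn hwin hg hguard β hβ
  classical
  have hn₁ : n₁ ≤ n := ((le_max_left _ _).trans (le_max_left _ _)).trans hn
  have hn₂ : n₂ ≤ n := ((le_max_right _ _).trans (le_max_left _ _)).trans hn
  have hnc : ⌈2 / μ'⌉₊ ≤ n := (le_max_right _ _).trans hn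
  have hn0 : (0 : ℝ) ≤ n := Nat.cast_nonneg _
  -- the block length
  set m : ℕ := ⌊μ' * n⌋₊ with hm
  have hmle : (m : ℝ) ≤ μ' * n := Nat.floor_le (by positivity)
  have hm1 : (m : ℝ) ≤ μ₁ * n := hmle.trans (by gcongr)
  have hm2 : (m : ℝ) ≤ μ₂ * n := hmle.trans (by gcongr)
  have hmn : m ≤ n := Nat.floor_le_of_le (by nlinarith)
  have hμm : μ' / 2 * (n : ℝ) ≤ m := by
    have h1 : 2 / μ' ≤ n := (Nat.le_ceil _).trans (by exact_mod_cast hnc)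
    rw [div_le_iff₀ hμ'0] at h1
    have h3 := Nat.lt_floor_add_one (μ' * n)
    linarith
  -- the mask: the low block
  obtain ⟨D, hD⟩ : ∃ D : QReg n, D = fun j : Fin n => decide ((j : ℕ) < m) := ⟨_, rfl⟩
  have hDcard : (Finset.univ.filter fun j => D j = true).card = m := by
    refine le_antisymm ?_ (hD ▸ le_card_filter_lt n m hmn)
    calc (Finset.univ.filter fun j => D j = true).card ≤ (Finset.range m).card :=
          Finset.card_le_card_of_injOn (fun j => (j : ℕ)) (fun j hj => by
            rw [Finset.coe_filter, Set.mem_setOf_eq, hD] at hj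
            simpa using hj) (fun j _ j' _ h => Fin.ext h)
      _ = m := Finset.card_range m
  refine ⟨D, by rw [hDcard]; exact hμm, ?_⟩
  have hPJ : (Finset.univ.filter fun u : QReg n => ∀ j : Fin n, D j = false → u j = false) =
      Finset.univ.filter fun u : QReg n => ∀ j : Fin n, m ≤ (j : ℕ) → u j = false := by
    simp only [hD, decide_eq_false_iff_not, not_lt]
  rw [hPJ, hDcard]
  -- abbreviations
  set G : ZMod p := (g : ZMod p) with hG
  set F : ZMod p → ℝ := fun y =>
    ∏ i : Fin n, (if β i && y.val.testBit (i : ℕ) then (-1 : ℝ) else 1) with hFdef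
  set U := Finset.univ.filter fun u : QReg n => ∀ j : Fin n, m ≤ (j : ℕ) → u j = false with hU
  set Q := (U ×ˢ U) ×ˢ (U ×ˢ U) with hQ'
  set pr : ((QReg n × QReg n) × (QReg n × QReg n)) → Prop := fun q =>
    (q.1.1 = q.1.2 ∧ q.2.1 = q.2.2) ∨ (q.1.1 = q.2.1 ∧ q.1.2 = q.2.2) ∨
      (q.1.1 = q.2.2 ∧ q.1.2 = q.2.1) with hpr
  set di : ((QReg n × QReg n) × (QReg n × QReg n)) → Prop := fun q =>
    q.1.1 ≠ q.1.2 ∧ q.1.1 ≠ q.2.1 ∧ q.1.1 ≠ q.2.2 ∧ q.1.2 ≠ q.2.1 ∧ q.1.2 ≠ q.2.2 ∧ q.2.1 ≠ q.2.2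
    with hdi
  set K : ((QReg n × QReg n) × (QReg n × QReg n)) → ℝ := fun q => ∑ lam : ZMod p,
    F (lam * G ^ Nat.ofBits q.1.1) * F (lam * G ^ Nat.ofBits q.1.2) *
      (F (lam * G ^ Nat.ofBits q.2.1) * F (lam * G ^ Nat.ofBits q.2.2)) with hK
  -- the two hypotheses at block length `m`, and the goal, through the abbreviations
  have hPS : ∑ h ∈ Finset.Ico 1 (2 ^ m), |∑ lam : ZMod p, F lam * F (lam * G ^ h)| ≤
      C₁ * (2 : ℝ) ^ ((1 - κ₁) * (m : ℝ)) * (p : ℝ) := hP n hn₁ p g hpn hwin hg β hβ m hm1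
  have hQS : ∑ q ∈ Q.filter di, |K q| ≤ C₂ * (2 : ℝ) ^ ((3 - κ₂) * (m : ℝ)) * (p : ℝ) :=
    hQ n hn₂ p g hpn hwin hg hguard β hβ m hm2
  change ∑ q ∈ Q.filter (fun q => ¬ pr q), |K q| ≤
    (12 * C₁ + C₂) * (2 : ℝ) ^ ((3 - min κ₁ κ₂) * (m : ℝ)) * (p : ℝ)
  -- basic facts
  have hp : p.Prime := hpF.out
  have hG0 : G ≠ 0 := by
    intro h0
    rw [h0, orderOf_eq_zero_iff'.mpr] at hg
    · have := hp.two_le; omega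
    · intro k hk h1
      rw [zero_pow (Nat.pos_iff_ne_zero.mp hk)] at h1
      exact zero_ne_one h1
  have hFF : ∀ y, F y * F y = 1 := fun y => by
    rcases sign_prod_cases β (fun i : Fin n => y.val.testBit (i : ℕ)) with h | h <;>
      simp only [hFdef] at h ⊢ <;> rw [h] <;> norm_num
  have hUlt : ∀ u ∈ U, Nat.ofBits u < 2 ^ m := fun u hu =>
    ofBits_lt_of_high m u (Finset.mem_filter.1 hu).2
  have hUcard : (U.card : ℝ) ≤ (2 : ℝ) ^ m := by
    have h : U.card ≤ 2 ^ m :=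
      calc U.card ≤ (Finset.range (2 ^ m)).card :=
            Finset.card_le_card_of_injOn (fun u => Nat.ofBits u)
              (fun u hu => Finset.mem_coe.2 (Finset.mem_range.2 (hUlt u hu)))
              (fun u _ v _ h => ofBits_injective h)
        _ = 2 ^ m := Finset.card_range _
    exact_mod_cast h
  -- the off-diagonal pair correlations, row by row
  have hΦ : ∑ a ∈ U, ∑ b ∈ U, (if a = b then 0 else
      |∑ lam : ZMod p, F (lam * G ^ Nat.ofBits a) * F (lam * G ^ Nat.ofBits b)|) ≤
      U.card * (2 * ∑ h ∈ Finset.Ico 1 (2 ^ m), |∑ lam : ZMod p, F lam * F (lam * G ^ h)|) := by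
    have := Finset.sum_le_sum fun a ha => row_corr_le F G hG0 m U hUlt a (hUlt a ha)
    rwa [Finset.sum_const, nsmul_eq_mul] at this
  -- numerics
  have h2 : (1 : ℝ) ≤ 2 := by norm_num
  have hm0 : (0 : ℝ) ≤ m := Nat.cast_nonneg _
  have hκ1 : min κ₁ κ₂ ≤ κ₁ := min_le_left _ _
  have hκ2 : min κ₁ κ₂ ≤ κ₂ := min_le_right _ _
  have hX1 : (2 : ℝ) ^ m * (2 : ℝ) ^ m * (2 : ℝ) ^ ((1 - κ₁) * (m : ℝ)) ≤
      (2 : ℝ) ^ ((3 - min κ₁ κ₂) * (m : ℝ)) := by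
    rw [← Real.rpow_natCast, ← Real.rpow_add two_pos, ← Real.rpow_add two_pos]
    exact Real.rpow_le_rpow_of_exponent_le h2 (by nlinarith)
  have hX2 : (2 : ℝ) ^ ((3 - κ₂) * (m : ℝ)) ≤ (2 : ℝ) ^ ((3 - min κ₁ κ₂) * (m : ℝ)) :=
    Real.rpow_le_rpow_of_exponent_le h2 (by nlinarith)
  calc ∑ q ∈ Q.filter (fun q => ¬ pr q), |K q|
      ≤ ∑ q ∈ Q.filter di, |K q| + 6 * (U.card * ∑ a ∈ U, ∑ b ∈ U, (if a = b then 0 else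
          |∑ lam : ZMod p, F (lam * G ^ Nat.ofBits a) * F (lam * G ^ Nat.ofBits b)|)) :=
        sum_nonpaired_le (fun u lam => F (lam * G ^ Nat.ofBits u)) (fun u lam => hFF _) U
    _ ≤ C₂ * (2 : ℝ) ^ ((3 - κ₂) * (m : ℝ)) * p + 6 * (U.card * (U.card *
          (2 * ∑ h ∈ Finset.Ico 1 (2 ^ m), |∑ lam : ZMod p, F lam * F (lam * G ^ h)|))) := by
        gcongr
    _ ≤ C₂ * (2 : ℝ) ^ ((3 - κ₂) * (m : ℝ)) * p + 6 * ((2 : ℝ) ^ m * ((2 : ℝ) ^ m *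
          (2 * (C₁ * (2 : ℝ) ^ ((1 - κ₁) * (m : ℝ)) * p)))) := by
        gcongr
    _ = C₂ * ((2 : ℝ) ^ ((3 - κ₂) * (m : ℝ)) * p) +
          12 * C₁ * ((2 : ℝ) ^ m * (2 : ℝ) ^ m * (2 : ℝ) ^ ((1 - κ₁) * (m : ℝ))) * p := by ring
    _ ≤ C₂ * ((2 : ℝ) ^ ((3 - min κ₁ κ₂) * (m : ℝ)) * p) +
          12 * C₁ * (2 : ℝ) ^ ((3 - min κ₁ κ₂) * (m : ℝ)) * p := by
        gcongr
    _ = (12 * C₁ + C₂) * (2 : ℝ) ^ ((3 - min κ₁ κ₂) * (m : ℝ)) * p := by ring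

end Summit.QuantumAdvantage.QuantumAdvantage.Theorems.SymplecticPurity
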